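import Summits.CriticalPhenomena.PercolationContinuityZ3.Theorems.PercNearOneGluingNoHeavyLowerTailMajorityGluingQCertSym3TypeParts
import HarnessLib

/-!
# SPEC-ONLY degree-3 orbit certificates, digested entirely in TYPE SPACE (lane prim-rate, constants-miner 1, gen 38; NEXT-g38 item 1 levers (a)+(b))

Support file for the closed crux `NoHeavyLowerTail` (stmt-CriticalPhenomena-4575), majority-gluing line.  The parts of `…QCertSym3TypeParts` still carry
the four membership MASKS of every van den Berg–Kahn row (numbers of `2^m` bits, validated pattern by pattern by `maskOK`) and ENUMERATE every square
`(a·f₁ − b·f₂)²·x_t` over `|supp|²` monomials — at `m = 12` that is 1 234-digit literals and ≈ 7·10⁵ kernel contributions (32 files of 200 kB for one certificate),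
and `m ≥ 13` is out of reach.  Here both are removed:
* `cylMask m A X n` COMPUTES the mask of the cylinder `f(A,X)` (`testBit_cylMask`), so `maskOK` holds by a theorem (`maskOK_cylMask`): a row is the spec
  `RowZ = (A, X, B, Y, n, t)` and `RowZ.toE` fills in the masks (never evaluated by the kernel);
* a square is the spec `SqZ = (a, b, n, f₁, f₂, t)` with FORMS `FormZ` (kind `0`: the cylinder `f(p,q)`; else the variable `x_p`, `p = 2^m` being `δ`); its
  contributions are digested in type space as the four form-pair products `±n·a²/ab/b²·f·g·x_t` (`pairY`): cylinder × cylinder = `prodY` (two-slot table `tabM`),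
  cylinder × variable = the one-slot table `tabF`, variable × cylinder = the NEW middle-slot table `tabG` (`midSum_eq_evalC_tabG`), variable × variable = one code;
  `evalC_sqC3S_expand` is the algebra `Σ_{i,j} u_i u_j = a²Σ₁₁ − abΣ₁₂ − abΣ₂₁ + b²Σ₂₂`.
`SymCert3Z` (base, `ell2`, `lin`, spec rows, spec squares) translates to a `SymCert3` (`toS`); `wf3S_toS` (cheap index checks `wfZ` ⟹ the entry-wise check of the
translation).  THIS FILE: `cylMask`, the specs and the translation, `wfZ`/`wf3S_toS`, the middle-slot table `tabG` with its counting lemma, and the enumeration-side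
algebra (`evalC_prodC3S_dsum`, `evalC_sqC3S_dsum`, `evalC_sqC3S_expand`, `evalC_prod_cv/vc/vv`).  The digest `digestZ`, its soundness `evalC_contribsZ` and the gluing
theorems (`pos_of_digestsZ`, `checkW3S_concatZ`) are `…QCertSym3TypeZParts`.  No sorries.
-/

namespace Summit.CriticalPhenomena.PercolationContinuityZ3.Theorems

namespace HubOnly
namespace QCert

/-! ### Cylinder masks computed from the spec -/

/-- The membership mask of the cylinder `f(A,X)` restricted to the patterns `< n`, built bit by bit. -/
def cylMask (m A X : ℕ) : ℕ → ℕ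
  | 0 => 0
  | n + 1 => cylMask m A X n ||| cond (cylMem m A X n) (2 ^ n) 0

/-- Its bits. -/
theorem testBit_cylMask (m A X : ℕ) : ∀ n K, (cylMask m A X n).testBit K = (decide (K < n) && cylMem m A X K)
  | 0, K => by simp [cylMask]
  | n + 1, K => by
    rw [cylMask, Nat.testBit_lor, testBit_cylMask m A X n K]
    rcases Nat.lt_trichotomy K n with h | h | h
    · have h1 : decide (K < n) = true := decide_eq_true h
      have h2 : decide (K < n + 1) = true := decide_eq_true (by omega)
      have h3 : (cond (cylMem m A X n) (2 ^ n) 0).testBit K = false := by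
        cases cylMem m A X n
        · simp
        · simp only [cond_true, Nat.testBit_two_pow]; exact decide_eq_false (by omega)
      rw [h1, h2, h3]; simp
    · subst h
      have h1 : decide (K < K) = false := decide_eq_false (lt_irrefl _)
      have h2 : decide (K < K + 1) = true := decide_eq_true (by omega)
      rw [h1, h2]
      cases cylMem m A X K <;> simp [Nat.testBit_two_pow_self]
    · have h1 : decide (K < n) = false := decide_eq_false (by omega)
      have h2 : decide (K < n + 1) = false := decide_eq_false (by omega)
      have h3 : (cond (cylMem m A X n) (2 ^ n) 0).testBit K = false := by
        cases cylMem m A X n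
        · simp
        · simp only [cond_true, Nat.testBit_two_pow]; exact decide_eq_false (by omega)
      rw [h1, h2, h3]; simp

/-- It has no bits at `n` and above. -/
theorem cylMask_lt (m A X n : ℕ) : cylMask m A X n < 2 ^ n := by
  refine Nat.lt_pow_two_of_testBit _ fun i hi => ?_
  rw [testBit_cylMask, decide_eq_false (by omega)]; rfl

/-- **The computed mask passes `maskOK`.** -/
theorem maskOK_cylMask (c : Cert) (A X : ℕ) : c.maskOK A X (cylMask c.m A X (2 ^ c.m)) = true := by
  unfold Cert.maskOK
  rw [Bool.and_eq_true, Nat.blt_eq, List.all_eq_true]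
  refine ⟨cylMask_lt _ _ _ _, fun K hK => ?_⟩
  rw [tb_eq, testBit_cylMask, decide_eq_true (List.mem_range.mp hK), Bool.true_and]
  cases cylMem c.m A X K <;> rfl

/-! ### Spec-level entries and their translation -/

/-- A van den Berg–Kahn row times `x_t`, by its spec: `n·(f(A∪B, X∩Y)·f(∅, X∪Y) − f(A,X)·f(B,Y))·x_t`. -/
structure RowZ where
  /-- attached set of the first factor -/
  A : ℕ
  /-- cut set of the first factor -/
  X : ℕ
  /-- attached set of the second factor -/
  B : ℕ
  /-- cut set of the second factor -/
  Y : ℕ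
  /-- the multiplier -/
  n : ℕ
  /-- the lift variable -/
  t : ℕ

/-- The row with its four masks COMPUTED. -/
def RowZ.toE (m : ℕ) (r : RowZ) : RowE3 :=
  ⟨⟨r.A, r.X, r.B, r.Y, r.n, cylMask m r.A r.X (2 ^ m), cylMask m r.B r.Y (2 ^ m), cylMask m (r.A ||| r.B) (r.X &&& r.Y) (2 ^ m),
    cylMask m 0 (r.X ||| r.Y) (2 ^ m)⟩, r.t⟩

/-- A linear form by its spec: kind `0` = the cylinder `f(p, q)` (`p` attached, `q` cut); otherwise the single variable `x_p` (`p = 2^m` is `δ`). -/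
structure FormZ where
  /-- `0` = cylinder, else variable -/
  kd : ℕ
  /-- attached set / variable index -/
  p : ℕ
  /-- cut set (cylinders only) -/
  q : ℕ

/-- The mask of a form. -/
def FormZ.mask (m : ℕ) (f : FormZ) : ℕ := if f.kd = 0 then cylMask m f.p f.q (2 ^ m) else 2 ^ f.p

/-- Index ranges of a form. -/
def FormZ.ok (m : ℕ) (f : FormZ) : Bool := if f.kd = 0 then decide (f.p < 2 ^ m) && decide (f.q < 2 ^ m) else decide (f.p < 2 ^ m + 1)

/-- A square times `x_t`, by its spec: `n·(a·f₁ − b·f₂)²·x_t`. -/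
structure SqZ where
  /-- coefficient of the first form -/
  a : ℕ
  /-- coefficient of the second form -/
  b : ℕ
  /-- the multiplier -/
  n : ℕ
  /-- first form -/
  f1 : FormZ
  /-- second form -/
  f2 : FormZ
  /-- the lift variable -/
  t : ℕ

/-- The square with its two masks COMPUTED. -/
def SqZ.toE (m : ℕ) (s : SqZ) : SqE3 := ⟨⟨s.a, s.b, s.n, s.f1.mask m, s.f2.mask m⟩, s.t⟩

/-- **A spec-only symmetrised degree-3 certificate** (a part): cell parameters, `ell2`, `lin` as in `SymCert3`, spec rows and spec squares (chunked). -/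
structure SymCert3Z where
  /-- `m, h, cN, cD` -/
  base : Cert
  /-- `(a, b, n)`: `n·(cN·x_D − cD·T)·x_a·x_b` -/
  ell2 : List (ℕ × ℕ × ℕ)
  /-- `(x, a, b, n)`: `n·(x_D − m_x)·x_a·x_b` -/
  lin : List (ℕ × ℕ × ℕ × ℕ)
  /-- spec rows, chunked -/
  rows : List (List RowZ)
  /-- spec squares, chunked -/
  sqs : List (List SqZ)

namespace SymCert3Z

variable (z : SymCert3Z)

/-- **The translation** to a `SymCert3` (masks computed, never evaluated by the checker). -/
def toS : SymCert3 := ⟨z.base, z.ell2, z.lin, z.rows.map fun ch => ch.map (RowZ.toE z.base.m), z.sqs.map fun ch => ch.map (SqZ.toE z.base.m)⟩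

/-- Its base. -/
theorem toS_base : z.toS.base = z.base := rfl

/-- **The cheap entry-wise check**: index ranges only. -/
def wfZ : Bool :=
  z.ell2.all (fun e => decide (e.1 < z.base.NV) && decide (e.2.1 < z.base.NV)) &&
    z.lin.all (fun e => decide (e.1 < z.base.m) && decide (e.2.1 < z.base.NV) && decide (e.2.2.1 < z.base.NV)) &&
    z.rows.all (fun ch => ch.all fun r => decide (r.A < 2 ^ z.base.m) && decide (r.X < 2 ^ z.base.m) && decide (r.B < 2 ^ z.base.m) &&
      decide (r.Y < 2 ^ z.base.m) && decide (r.t < z.base.NV)) &&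
    z.sqs.all (fun ch => ch.all fun s => s.f1.ok z.base.m && s.f2.ok z.base.m && decide (s.t < z.base.NV))

/-- A spec row with sets in range translates to a well-formed row. -/
theorem rowOK_toE (c : Cert) (r : RowZ) (hA : r.A < 2 ^ c.m) (hX : r.X < 2 ^ c.m) (hB : r.B < 2 ^ c.m) (hY : r.Y < 2 ^ c.m) :
    c.rowOK (r.toE c.m).row = true := by
  unfold Cert.rowOK RowZ.toE
  simp only [hA, hX, hB, hY, decide_true, maskOK_cylMask, Bool.and_self]

/-- `wfZ` unpacked. -/
theorem wfZ_entries (h : z.wfZ = true) :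
    (∀ e ∈ z.ell2, e.1 < z.base.NV ∧ e.2.1 < z.base.NV) ∧ (∀ e ∈ z.lin, e.1 < z.base.m ∧ e.2.1 < z.base.NV ∧ e.2.2.1 < z.base.NV) ∧
      (∀ ch ∈ z.rows, ∀ r ∈ ch, r.A < 2 ^ z.base.m ∧ r.X < 2 ^ z.base.m ∧ r.B < 2 ^ z.base.m ∧ r.Y < 2 ^ z.base.m ∧ r.t < z.base.NV) ∧
      (∀ ch ∈ z.sqs, ∀ s ∈ ch, s.f1.ok z.base.m = true ∧ s.f2.ok z.base.m = true ∧ s.t < z.base.NV) := by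
  unfold wfZ at h
  simp only [Bool.and_eq_true, List.all_eq_true, decide_eq_true_eq] at h
  obtain ⟨⟨⟨he, hl⟩, hr⟩, hs⟩ := h
  exact ⟨fun e he' => he e he', fun e he' => ⟨(hl e he').1.1, (hl e he').1.2, (hl e he').2⟩,
    fun ch hch r hr' => ⟨(hr ch hch r hr').1.1.1.1, (hr ch hch r hr').1.1.1.2, (hr ch hch r hr').1.1.2, (hr ch hch r hr').1.2, (hr ch hch r hr').2⟩,
    fun ch hch s hs' => ⟨(hs ch hch s hs').1.1, (hs ch hch s hs').1.2, (hs ch hch s hs').2⟩⟩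

/-- **The translation of a checked part passes the entry-wise check `wf3S`.** -/
theorem wf3S_toS (h : z.wfZ = true) : z.toS.wf3S = true := by
  obtain ⟨he, hl, hr, hs⟩ := z.wfZ_entries h
  unfold SymCert3.wf3S
  simp only [Bool.and_eq_true, List.all_eq_true, decide_eq_true_eq]
  refine ⟨⟨⟨fun e he' => he e he', fun e he' => ⟨⟨(hl e he').1, (hl e he').2.1⟩, (hl e he').2.2⟩⟩, fun ch hch r hr' => ?_⟩, fun ch hch s hs' => ?_⟩
  · obtain ⟨ch₀, hch₀, rfl⟩ := List.mem_map.1 hch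
    obtain ⟨r₀, hr₀, rfl⟩ := List.mem_map.1 hr'
    obtain ⟨hA, hX, hB, hY, ht⟩ := hr ch₀ hch₀ r₀ hr₀
    exact ⟨rowOK_toE z.base r₀ hA hX hB hY, ht⟩
  · obtain ⟨ch₀, hch₀, rfl⟩ := List.mem_map.1 hch
    obtain ⟨s₀, hs₀, rfl⟩ := List.mem_map.1 hs'
    exact (hs ch₀ hch₀ s₀ hs₀).2.2

end SymCert3Z

/-! ### The middle-slot table (variable × cylinder products) -/

/-- The cells relay `x` may contribute when the MIDDLE slot varies over the cylinder `(A, X)` and the slots `a` (first), `b` (third) are fixed. -/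
def cellsAtG (A X a b x : ℕ) : List ℕ := (allowedBits A X x).map fun b₂ => (cond (tb a x) 4 0 + 2 * b₂) + cond (tb b x) 1 0

/-- The merged middle-slot table. -/
def tabG (Bs A X a b fuel : ℕ) : ℕ → List (ℕ × ℤ)
  | 0 => [(0, 1)]
  | n + 1 => aggr (msort2 fuel (stepU Bs (cellsAtG A X a b n) (tabG Bs A X a b fuel n)))

noncomputable section

/-- The middle-slot cylinder sum. -/
def midSum (Bs A X a b n : ℕ) (g : ℕ → ℝ) : ℝ := ((cylR n A X).map fun K => g (cvcode Bs n a K b)).sum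

/-- The new relay's cell with the middle slot varying. -/
theorem cell_mid (a K b n b₂ : ℕ) (h₂ : tb K n = decide (b₂ = 1)) (hb₂ : b₂ ≤ 1) :
    cell a K b n = (cond (tb a n) 4 0 + 2 * b₂) + cond (tb b n) 1 0 := by
  unfold cell; rw [h₂]
  interval_cases b₂ <;> cases tb a n <;> cases tb b n <;> simp

/-- **The middle-slot counting lemma.** -/
theorem midSum_eq_evalC_tabG (Bs A X a b fuel : ℕ) : ∀ (n : ℕ) (g : ℕ → ℝ), midSum Bs A X a b n g = evalC g (tabG Bs A X a b fuel n)
  | 0, g => by simp [midSum, cylR, cylB, cvcode, tabG, evalC]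
  | n + 1, g => by
    have IH := midSum_eq_evalC_tabG Bs A X a b fuel n
    rw [tabG, evalC_aggr, evalC_perm g (msort2_perm fuel _), evalC_stepU]
    unfold midSum
    rw [cylR_succ' n A X, sum_map_flatMap]
    unfold cellsAtG
    rw [List.map_map]
    refine congrArg List.sum (List.map_congr_left fun b₂ hb₂ => ?_)
    have hb₂' := le_one_of_mem_allowedBits hb₂
    rw [List.map_map]
    simp only [Function.comp]
    rw [← IH]
    unfold midSum
    refine congrArg List.sum (List.map_congr_left fun K hK => ?_)
    have hs := cvcode_shift Bs n a K b 0 b₂ (by norm_num) hb₂'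
    rw [zero_mul, zero_add] at hs
    simp only [Function.comp]
    rw [cvcode_succ, hs, cell_mid a _ b n b₂ (tb_bit_shift n K b₂ (lt_of_mem_cylR hK) hb₂') hb₂']

/-! ### Small list facts -/

/-- The support of the single-variable mask `2^p` below `N > p` is `[p]`. -/
theorem filter_range_eq_single (p : ℕ) : ∀ N, p < N → (List.range N).filter (fun K => tb (2 ^ p) K) = [p]
  | 0, h => absurd h (Nat.not_lt_zero _)
  | N + 1, h => by
    rw [List.range_succ, List.filter_append, List.filter_singleton, tb_eq, Nat.testBit_two_pow]
    by_cases hp : p = N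
    · subst hp
      have h0 : (List.range p).filter (fun K => tb (2 ^ p) K) = [] := by
        rw [List.filter_eq_nil_iff]
        intro K hK
        rw [tb_eq, Nat.testBit_two_pow]
        exact by simpa using (Nat.ne_of_gt (List.mem_range.mp hK))
      rw [h0]; simp
    · rw [filter_range_eq_single p N (by omega), decide_eq_false hp]; simp

/-- `suppOf N (tb (2^p)) = [p]` for `p < N`. -/
theorem suppOf_two_pow (N p : ℕ) (hp : p < N) : suppOf N (tb (2 ^ p)) = [p] := by
  unfold suppOf; exact filter_range_eq_single p N hp

/-- A double sum over `range N × range N`. -/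
def dsum (N : ℕ) (F : ℕ → ℕ → ℝ) : ℝ := ((List.range N).map fun i => ((List.range N).map fun j => F i j).sum).sum

/-- `dsum` is additive. -/
theorem dsum_add (N : ℕ) (F G : ℕ → ℕ → ℝ) : dsum N F + dsum N G = dsum N fun i j => F i j + G i j := by
  unfold dsum
  rw [← List.sum_map_add]
  refine congrArg List.sum (List.map_congr_left fun i _ => ?_)
  rw [← List.sum_map_add]

/-- `tb` of a bitwise or. -/
theorem tb_lor (m1 m2 i : ℕ) : tb (m1 ||| m2) i = (tb m1 i || tb m2 i) := by
  rw [tb_eq, tb_eq, tb_eq, Nat.testBit_lor]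

namespace SymCert3

variable (c : SymCert3)

/-- An enumerated form-pair product as an indicator double sum. -/
theorem evalC_prodC3S_dsum (val : ℕ → ℝ) (m1 m2 t : ℕ) (z : ℤ) :
    evalC val (c.prodC3S m1 m2 t z) = dsum c.NV fun i j => if tb m1 i then (if tb m2 j then (z : ℝ) * val (c.key i j t) else 0) else 0 := by
  rw [evalC_prodC3S_lists]
  unfold dsum suppOf
  rw [sum_map_filter (List.range c.NV) (tb m1), ← List.sum_map_mul_left]
  refine congrArg List.sum (List.map_congr_left fun i _ => ?_)
  beta_reduce
  by_cases hi : tb m1 i = true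
  · simp only [hi, if_true]
    rw [sum_map_filter (List.range c.NV) (tb m2), ← List.sum_map_mul_left]
    refine congrArg List.sum (List.map_congr_left fun j _ => ?_)
    by_cases hj : tb m2 j = true
    · rw [if_pos hj, if_pos hj]
    · rw [if_neg hj, if_neg hj, mul_zero]
  · simp [hi]

/-- An enumerated square as an indicator double sum. -/
theorem evalC_sqC3S_dsum (val : ℕ → ℝ) (s : SqE3) :
    evalC val (c.sqC3S s) = dsum c.NV fun i j => if tb (s.sq.m1 ||| s.sq.m2) i then
      (if tb (s.sq.m1 ||| s.sq.m2) j then ((-((s.sq.n : ℤ) * s.sq.u i * s.sq.u j) : ℤ) : ℝ) * val (c.key i j s.t) else 0) else 0 := by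
  unfold sqC3S dsum suppOf
  rw [evalC_flatten, List.map_map, sum_map_filter (List.range c.NV) (tb (s.sq.m1 ||| s.sq.m2))]
  refine congrArg List.sum (List.map_congr_left fun i _ => ?_)
  simp only [Function.comp_apply]
  by_cases hi : tb (s.sq.m1 ||| s.sq.m2) i = true
  · simp only [hi, if_true]
    unfold evalC
    rw [List.map_map, sum_map_filter (List.range c.NV) (tb (s.sq.m1 ||| s.sq.m2))]
    refine congrArg List.sum (List.map_congr_left fun j _ => ?_)
    simp only [Function.comp_apply]
  · simp [hi]

/-- **The square expands into its four form-pair products** (any masks): `Σ u_i u_j = a²Σ₁₁ − abΣ₁₂ − abΣ₂₁ + b²Σ₂₂`. -/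
theorem evalC_sqC3S_expand (val : ℕ → ℝ) (s : SqE3) :
    evalC val (c.sqC3S s) =
      evalC val (c.prodC3S s.sq.m1 s.sq.m1 s.t (-((s.sq.n : ℤ) * s.sq.a * s.sq.a)) ++ c.prodC3S s.sq.m1 s.sq.m2 s.t ((s.sq.n : ℤ) * s.sq.a * s.sq.b) ++
        c.prodC3S s.sq.m2 s.sq.m1 s.t ((s.sq.n : ℤ) * s.sq.a * s.sq.b) ++ c.prodC3S s.sq.m2 s.sq.m2 s.t (-((s.sq.n : ℤ) * s.sq.b * s.sq.b))) := by
  rw [evalC_append, evalC_append, evalC_append, evalC_sqC3S_dsum, evalC_prodC3S_dsum, evalC_prodC3S_dsum, evalC_prodC3S_dsum, evalC_prodC3S_dsum,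
    dsum_add, dsum_add, dsum_add]
  congr 1
  funext i j
  have hi := tb_lor s.sq.m1 s.sq.m2 i
  have hj := tb_lor s.sq.m1 s.sq.m2 j
  unfold SqE.u
  rw [hi, hj]
  cases tb s.sq.m1 i <;> cases tb s.sq.m2 i <;> cases tb s.sq.m1 j <;> cases tb s.sq.m2 j <;>
    simp only [Bool.or_true, Bool.or_false, Bool.false_eq_true, if_true, if_false] <;>
      push_cast <;> ring

/-- A one-entry contribution list. -/
theorem evalC_single (val : ℕ → ℝ) (k : ℕ) (z : ℤ) : evalC val [(k, z)] = (z : ℝ) * val k := by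
  simp [evalC]

/-- **Cylinder × variable** products in type space (first slot over `f(A,X)`, second slot the variable `x_p`, `p ≤ 2^m`). -/
theorem evalC_prod_cv (val : ℕ → ℝ) (A X p t : ℕ) (z : ℤ) (hX : X < 2 ^ c.base.m) (hp : p < c.NV) (ht : t < c.NV) :
    evalC val (c.prodC3S (cylMask c.base.m A X (2 ^ c.base.m)) (2 ^ p) t z) =
      evalC val (c.keyTab false (p == c.base.D) (t == c.base.D) z (tabF c.Bs A X p t fuelY c.base.m)) := by
  obtain ⟨h1a, h1b⟩ := maskOK_spec c.base A X _ (maskOK_cylMask c.base A X)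
  have hNV : c.NV = 2 ^ c.base.m + 1 := rfl
  rw [evalC_prodC3S_lists, hNV, suppOf_mask_eq_cylR c.base.m A X _ h1a hX h1b, suppOf_two_pow _ p (hNV ▸ hp)]
  unfold keyTab
  rw [evalC_map_key, ← fixSum_eq_evalC_tabF]
  unfold fixSum
  congr 1
  refine congrArg List.sum (List.map_congr_left fun i hi => ?_)
  have hi' := lt_of_mem_cylR hi
  rw [List.map_singleton, List.sum_singleton, c.val_key_eq val i p t (by omega) (hNV ▸ hp) (hNV ▸ ht), show c.base.D = 2 ^ c.base.m from rfl,
    beq_D_false hi']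

/-- **Variable × cylinder** products in type space (first slot the variable `x_p`, second slot over `f(A,X)`): the middle-slot table. -/
theorem evalC_prod_vc (val : ℕ → ℝ) (p A X t : ℕ) (z : ℤ) (hp : p < c.NV) (hX : X < 2 ^ c.base.m) (ht : t < c.NV) :
    evalC val (c.prodC3S (2 ^ p) (cylMask c.base.m A X (2 ^ c.base.m)) t z) =
      evalC val (c.keyTab (p == c.base.D) false (t == c.base.D) z (tabG c.Bs A X p t fuelY c.base.m)) := by
  obtain ⟨h1a, h1b⟩ := maskOK_spec c.base A X _ (maskOK_cylMask c.base A X)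
  have hNV : c.NV = 2 ^ c.base.m + 1 := rfl
  rw [evalC_prodC3S_lists, hNV, suppOf_mask_eq_cylR c.base.m A X _ h1a hX h1b, suppOf_two_pow _ p (hNV ▸ hp), List.map_singleton, List.sum_singleton]
  unfold keyTab
  rw [evalC_map_key, ← midSum_eq_evalC_tabG]
  unfold midSum
  congr 1
  refine congrArg List.sum (List.map_congr_left fun j hj => ?_)
  have hj' := lt_of_mem_cylR hj
  rw [c.val_key_eq val p j t (hNV ▸ hp) (by omega) (hNV ▸ ht), show c.base.D = 2 ^ c.base.m from rfl, beq_D_false hj']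

/-- **Variable × variable** products: one code. -/
theorem evalC_prod_vv (val : ℕ → ℝ) (p p' t : ℕ) (z : ℤ) (hp : p < c.NV) (hp' : p' < c.NV) (ht : t < c.NV) :
    evalC val (c.prodC3S (2 ^ p) (2 ^ p') t z) =
      evalC val [(keyOfCode c.base.m c.Bs (p == c.base.D) (p' == c.base.D) (t == c.base.D) (cvcode c.Bs c.base.m p p' t), z)] := by
  have hNV : c.NV = 2 ^ c.base.m + 1 := rfl
  rw [evalC_prodC3S_lists, suppOf_two_pow _ p hp, suppOf_two_pow _ p' hp', List.map_singleton, List.sum_singleton, List.map_singleton, List.sum_singleton,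
    evalC_single, c.val_key_eq val p p' t (hNV ▸ hp) (hNV ▸ hp') (hNV ▸ ht)]

end SymCert3

end

end QCert
end HubOnly

end Summit.CriticalPhenomena.PercolationContinuityZ3.Theorems
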